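import Literature.NumberTheory.EllipticCurves.TateModuleContinuityProofs
import Literature.NumberTheory.GaloisRepresentations.CyclotomicCharacterSurjectiveProofs
import HarnessLib

/-!
# Class X9, twisted hypothesis (im): the Teichmüller-type lift in `Γ_ℚ` (compactness step)

HONEST FRAMING (cell `b2b-bsdres`, X9 prover lineage): a lemma about the Galois action on the
`p`-adic Tate module of an elliptic curve over `ℚ`, serving the kernel proof of the obligation node
`Summit.BirchSwinnertonDyer.BirchSwinnertonDyer.Rank1Residual.X9TwistedHypothesisIm`
(`Theorems/Rank1ResidualX9SmallImageKolyvagin`, cell `bsd-smallim`).  No class-level claim is made.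

**Theorem** (`exists_smul_eq_and_galoisRepTate_pow_eq_one`).  Let `E = W/ℚ`, `p` a prime,
`σ₁ ∈ Γ_ℚ` fixing the `p`-th roots of unity of `ℚ̄`, and `m ≥ 1` prime to `p` with `σ₁^m` acting
trivially on `E[p]`.  Then there is `σ ∈ Γ_ℚ` fixing EVERY `p`-power root of unity
(`σ ∈ G_{ℚ(μ_{p^∞})}`), acting on `E[p]` exactly as `σ₁`, and with `ρ_{E,p}(σ)^m = 1` on the Tate
module `T_pE` — a "multiplicative Jordan component" of `σ₁`, produced inside `Γ_ℚ` rather than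
inside `GL₂(ℤ_p)`.

Proof.  With `N = φ(m)` (so `p^N ≡ 1 mod m`, Euler) put `e_n = p^{Nn}` and
`S_n = {σ | σ fixes μ_{p^n} and σ P = σ₁^{e_n} P for all P ∈ E[p^n]}`.  The level-raising lemma
(`pow_smul_eq_self_of_forall`: if `g` fixes `A[p^n]` pointwise, `n ≥ 1`, then `g^p` fixes
`A[p^{n+1}]` — for `P ∈ A[p^{n+1}]`, `Q = gP - P ∈ A[p]` is fixed by `g`, so `g^i P = P + iQ`;
likewise for roots of unity in `ℚ̄`, `pow_smul_eq_self_of_forall_pow_eq_one`) gives that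
`σ₁^{m p^k}` fixes `E[p^{k+1}]` and `σ₁^{p^k}` fixes `μ_{p^{k+1}}`; hence `σ₁^{e_n} ∈ S_n` and
`S_{n+1} ⊆ S_n` (`e_{n+1} - e_n = e_n (p^N - 1)` is a multiple of `m e_n`).  The `S_n` are closed
(`E(ℚ̄)` is a discrete `Γ_ℚ`-module, `continuousSMul_geomPoints'`; roots of unity:
`RootOfUnityAction.isClosed_setOf_forall_smul_eq`) and `Γ_ℚ` is compact, so some `σ` lies in
every `S_n`; then `σ^m` acts on `E[p^n]` as `σ₁^{m e_n} = 1`, i.e. `ρ(σ)^m = 1`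
(`TateModule.ext`), and on `E[p]` as `σ₁^{p^N} = σ₁`.

References: J.-P. Serre, *Abelian ℓ-adic representations and elliptic curves* (1968), Ch. I
§1.1 (`T_ℓ`, `Γ` compact acting continuously) [SerreAbelianLadic1968]; the argument is the
standard construction of the prime-to-`p` part of an element of a profinite group.
-/

noncomputable section

open scoped Classical
open Field

-- the summit and its single problem are both named `BirchSwinnertonDyer` (registry layout D-0017)
set_option linter.dupNamespace false

namespace Summit.BirchSwinnertonDyer.BirchSwinnertonDyer.Rank1Residual.TwistedIm

open Literature.NumberTheory.EllipticCurves Literature.NumberTheory.GaloisRepresentations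

/-! ### Level raising -/

section LevelRaising

variable {A G : Type*} [AddCommGroup A] [Monoid G] [DistribMulAction G A] {p : ℕ} {g : G}

/-- **Level raising, additive form.**  If `g` fixes every `P` with `p^n • P = 0` (`n ≥ 1`), then
`g^p` fixes every `P` with `p^{n+1} • P = 0`: `Q = g P - P` is `p`-torsion, hence fixed by `g`,
so `g^i P = P + i Q` and `g^p P = P + p Q = P`. [folklore] -/
theorem pow_smul_eq_self_of_forall {n : ℕ} (hn : n ≠ 0)
    (hg : ∀ P : A, p ^ n • P = 0 → g • P = P) (P : A) (hP : p ^ (n + 1) • P = 0) :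
    g ^ p • P = P := by
  obtain ⟨k, rfl⟩ := Nat.exists_eq_succ_of_ne_zero hn
  set Q : A := g • P - P with hQ
  have hpQ : p • Q = 0 := by
    have h1 : g • (p • P) = p • P := hg _ (by rw [smul_smul, ← pow_succ, hP])
    rw [hQ, smul_sub, smul_comm, h1, sub_self]
  have hgQ : g • Q = Q := hg Q (by rw [pow_succ, mul_smul, hpQ, smul_zero])
  have hiter : ∀ i : ℕ, g ^ i • P = P + i • Q := by
    intro i
    induction i with
    | zero => rw [pow_zero, one_smul, zero_smul, add_zero]
    | succ i ih =>
      rw [pow_succ', mul_smul, ih, smul_add, smul_comm, hgQ, add_smul, one_smul, hQ]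
      abel
  rw [hiter, hpQ, add_zero]

/-- Iterated level raising: if `g` fixes the `p`-torsion pointwise then `g^{p^k}` fixes the
`p^{k+1}`-torsion pointwise. [folklore] -/
theorem pow_pow_smul_eq_self_of_forall (hg : ∀ P : A, p • P = 0 → g • P = P) (k : ℕ) (P : A)
    (hP : p ^ (k + 1) • P = 0) : g ^ p ^ k • P = P := by
  induction k generalizing P with
  | zero =>
    rw [pow_zero, pow_one]
    exact hg P (by rwa [zero_add, pow_one] at hP)
  | succ k ih =>
    rw [pow_succ, pow_mul]
    exact pow_smul_eq_self_of_forall (g := g ^ p ^ k) (Nat.succ_ne_zero k) ih P hP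

/-- If `g` fixes the `p`-torsion pointwise, `p^n • P = 0` and `n ≤ k + 1`, then `(g^{p^k})^j` fixes
`P`. [folklore] -/
theorem pow_pow_pow_smul_eq_self_of_forall (hg : ∀ P : A, p • P = 0 → g • P = P) {k n : ℕ}
    (hnk : n ≤ k + 1) (j : ℕ) (P : A) (hP : p ^ n • P = 0) : (g ^ p ^ k) ^ j • P = P := by
  have hP' : p ^ (k + 1) • P = 0 := by
    rw [← Nat.add_sub_of_le hnk, pow_add, mul_comm, mul_smul, hP, smul_zero]
  have h1 : g ^ p ^ k • P = P := pow_pow_smul_eq_self_of_forall hg k P hP'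
  induction j with
  | zero => rw [pow_zero, one_smul]
  | succ j ih => rw [pow_succ, mul_smul, h1, ih]

end LevelRaising

section LevelRaisingUnits

variable {K G : Type*} [Field K] [Monoid G] [MulSemiringAction G K] {p : ℕ} {g : G}

/-- **Level raising for roots of unity.**  If `g` fixes the `p^n`-th roots of unity of the field
`K` (`n ≥ 1`, `p ≠ 0`), then `g^p` fixes the `p^{n+1}`-th roots of unity: for `t^{p^{n+1}} = 1`,
`q = g(t)/t` is a `p`-th root of unity, hence fixed, so `g^i t = q^i t`. [folklore] -/
theorem pow_smul_eq_self_of_forall_pow_eq_one (hp : p ≠ 0) {n : ℕ} (hn : n ≠ 0)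
    (hg : ∀ t : K, t ^ p ^ n = 1 → g • t = t) (t : K) (ht : t ^ p ^ (n + 1) = 1) :
    g ^ p • t = t := by
  obtain ⟨k, rfl⟩ := Nat.exists_eq_succ_of_ne_zero hn
  have ht0 : t ≠ 0 := by
    rintro rfl
    rw [zero_pow (pow_ne_zero _ hp)] at ht
    exact zero_ne_one ht
  have htp : g • t ^ p = t ^ p := hg _ (by rw [← pow_mul, ← pow_succ', ht])
  set q : K := g • t * t⁻¹ with hq
  have hgt : g • t = q * t := by rw [hq, inv_mul_cancel_right₀ ht0]
  have hqp : q ^ p = 1 := by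
    rw [hq, mul_pow, ← smul_pow', htp, inv_pow, mul_inv_cancel₀ (pow_ne_zero _ ht0)]
  have hgq : g • q = q := hg q (by rw [pow_succ', pow_mul, hqp, one_pow])
  have hiter : ∀ i : ℕ, g ^ i • t = q ^ i * t := by
    intro i
    induction i with
    | zero => rw [pow_zero, one_smul, pow_zero, one_mul]
    | succ i ih =>
      rw [pow_succ', mul_smul, ih, smul_mul', smul_pow', hgq, hgt, pow_succ]
      ring
  rw [hiter, hqp, one_mul]

/-- Iterated level raising for roots of unity: if `g` fixes the `p`-th roots of unity then
`g^{p^k}` fixes the `p^{k+1}`-th roots of unity. [folklore] -/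
theorem pow_pow_smul_eq_self_of_forall_pow_eq_one (hp : p ≠ 0)
    (hg : ∀ t : K, t ^ p = 1 → g • t = t) (k : ℕ) (t : K) (ht : t ^ p ^ (k + 1) = 1) :
    g ^ p ^ k • t = t := by
  induction k generalizing t with
  | zero =>
    rw [pow_zero, pow_one]
    exact hg t (by rwa [zero_add, pow_one] at ht)
  | succ k ih =>
    rw [pow_succ, pow_mul]
    exact pow_smul_eq_self_of_forall_pow_eq_one (g := g ^ p ^ k) hp (Nat.succ_ne_zero k) ih t ht

/-- If `g` fixes the `p`-th roots of unity, `t^{p^n} = 1` and `n ≤ k + 1`, then `(g^{p^k})^j`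
fixes `t`. [folklore] -/
theorem pow_pow_pow_smul_eq_self_of_forall_pow_eq_one (hp : p ≠ 0)
    (hg : ∀ t : K, t ^ p = 1 → g • t = t) {k n : ℕ} (hnk : n ≤ k + 1) (j : ℕ) (t : K)
    (ht : t ^ p ^ n = 1) : (g ^ p ^ k) ^ j • t = t := by
  have ht' : t ^ p ^ (k + 1) = 1 := by
    rw [← Nat.add_sub_of_le hnk, pow_add, pow_mul, ht, one_pow]
  have h1 : g ^ p ^ k • t = t := pow_pow_smul_eq_self_of_forall_pow_eq_one hp hg k t ht'
  induction j with
  | zero => rw [pow_zero, one_smul]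
  | succ j ih => rw [pow_succ, mul_smul, h1, ih]

end LevelRaisingUnits

/-! ### The lift -/

/-- **Teichmüller-type lift in `Γ_ℚ`.**  For an elliptic curve `E = W/ℚ`, a prime `p`,
`σ₁ ∈ Γ_ℚ` fixing `μ_p(ℚ̄)` and `m ≥ 1` prime to `p` with `σ₁^m` trivial on `E[p]`, there is
`σ ∈ Γ_ℚ` fixing all `p`-power roots of unity, with `ρ_{E,p}(σ)^m = 1` on `T_pE` and
`σ = σ₁` on `E[p]`.  See the module docstring for the proof (nested closed sets
`S_n ∋ σ₁^{p^{φ(m) n}}` in the compact group `Γ_ℚ`). [cite: SerreAbelianLadic1968, Ch. I §1.1] -/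
theorem exists_smul_eq_and_galoisRepTate_pow_eq_one (W : WeierstrassCurve ℚ) (p : ℕ)
    [Fact p.Prime] (σ₁ : absoluteGaloisGroup ℚ) {m : ℕ} (hm : m ≠ 0) (hpm : p.Coprime m)
    (hμ : ∀ t : AlgebraicClosure ℚ, t ^ p = 1 → σ₁ • t = t)
    (hE : ∀ P : W.geomPoints, p • P = 0 → σ₁ ^ m • P = P) :
    ∃ σ : absoluteGaloisGroup ℚ,
      (∀ (n : ℕ) (t : AlgebraicClosure ℚ), t ^ p ^ n = 1 → σ • t = t) ∧
      W.galoisRepTate p σ ^ m = 1 ∧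
      ∀ P : W.geomPoints, p • P = 0 → σ • P = σ₁ • P := by
  have hp : p.Prime := Fact.out
  have hp0 : p ≠ 0 := hp.ne_zero
  -- `N = φ(m) ≥ 1` with `p ^ N = m k + 1`
  set N : ℕ := Nat.totient m with hN
  have hN1 : 1 ≤ N := Nat.totient_pos.mpr (Nat.pos_of_ne_zero hm)
  obtain ⟨k, hk⟩ : ∃ k : ℕ, p ^ N = m * k + 1 := by
    have hmod : 1 ≡ p ^ N [MOD m] := (Nat.ModEq.pow_totient hpm).symm
    have h1 : 1 ≤ p ^ N := Nat.one_le_pow N p hp.pos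
    obtain ⟨k, hk⟩ := (Nat.modEq_iff_dvd' h1).mp hmod
    exact ⟨k, by rw [← hk, Nat.sub_add_cancel h1]⟩
  -- exponents `e n = p ^ (N n)`
  set e : ℕ → ℕ := fun n => p ^ (N * n) with he
  have he_succ : ∀ n, e (n + 1) = e n + m * (e n * k) := by
    intro n
    simp only [he]
    rw [Nat.mul_succ, pow_add, hk]
    ring
  have hle : ∀ n : ℕ, n ≤ N * n + 1 := fun n => by nlinarith
  -- `(σ₁^m)^(e n)` fixes `E[p^n]`, `σ₁^(e n)` fixes `μ_{p^n}`
  have hEfix : ∀ (n j : ℕ) (P : W.geomPoints), p ^ n • P = 0 →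
      ((σ₁ ^ m) ^ e n) ^ j • P = P := fun n j P hP =>
    pow_pow_pow_smul_eq_self_of_forall hE (hle n) j P hP
  have hμfix : ∀ (n j : ℕ) (t : AlgebraicClosure ℚ), t ^ p ^ n = 1 →
      (σ₁ ^ e n) ^ j • t = t := fun n j t ht =>
    pow_pow_pow_smul_eq_self_of_forall_pow_eq_one hp0 hμ (hle n) j t ht
  have hEk : ∀ (j : ℕ) (Q : W.geomPoints), p • Q = 0 → (σ₁ ^ m) ^ j • Q = Q := by
    intro j Q hQ
    induction j with
    | zero => rw [pow_zero, one_smul]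
    | succ j ih => rw [pow_succ, mul_smul, hE Q hQ, ih]
  -- the closed sets
  let S : ℕ → Set (absoluteGaloisGroup ℚ) := fun n =>
    {σ | ∀ t : AlgebraicClosure ℚ, t ^ p ^ n = 1 → σ • t = t} ∩
      {σ | ∀ P : W.geomPoints, p ^ n • P = 0 → σ • P = σ₁ ^ e n • P}
  haveI : ContinuousSMul (absoluteGaloisGroup ℚ) (W.geomPoints) := W.continuousSMul_geomPoints'
  have hSclosed : ∀ n, IsClosed (S n) := by
    intro n
    refine IsClosed.inter (RootOfUnityAction.isClosed_setOf_forall_smul_eq (p ^ n) fun t => t) ?_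
    have : {σ : absoluteGaloisGroup ℚ | ∀ P : W.geomPoints, p ^ n • P = 0 → σ • P = σ₁ ^ e n • P} =
        ⋂ (P : W.geomPoints) (_ : p ^ n • P = 0), {σ | σ • P = σ₁ ^ e n • P} := by
      ext σ; simp
    rw [this]
    refine isClosed_iInter fun P => isClosed_iInter fun _ => ?_
    exact isClosed_eq (continuous_id.smul continuous_const) continuous_const
  have hSne : ∀ n, (S n).Nonempty := by
    intro n
    refine ⟨σ₁ ^ e n, fun t ht => ?_, fun P _ => rfl⟩
    have := hμfix n 1 t ht
    rwa [pow_one] at this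
  have hSmono : ∀ n, S (n + 1) ⊆ S n := by
    intro n σ hσ
    refine ⟨fun t ht => hσ.1 t (by rw [pow_succ, pow_mul, ht, one_pow]), fun P hP => ?_⟩
    have hP' : p ^ (n + 1) • P = 0 := by rw [pow_succ', mul_smul, hP, smul_zero]
    rw [hσ.2 P hP', he_succ, pow_add, mul_smul, pow_mul, pow_mul, hEfix n k P hP]
  haveI : CompactSpace (absoluteGaloisGroup ℚ) := inferInstance
  obtain ⟨σ, hσ⟩ := IsCompact.nonempty_iInter_of_sequence_nonempty_isCompact_isClosed S hSmono
    hSne (isClosed_univ.isCompact.of_isClosed_subset (hSclosed 0) (Set.subset_univ _)) hSclosed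
  rw [Set.mem_iInter] at hσ
  -- powers of `σ` on `E[p^n]`
  have hσpow : ∀ (n j : ℕ) (P : W.geomPoints), p ^ n • P = 0 →
      σ ^ j • P = σ₁ ^ (j * e n) • P := by
    intro n j
    induction j with
    | zero => intro P _; rw [pow_zero, zero_mul, pow_zero]
    | succ j ih =>
      intro P hP
      have hP' : p ^ n • (σ₁ ^ (j * e n) • P) = 0 := by rw [smul_comm, hP, smul_zero]
      rw [pow_succ', mul_smul, ih P hP, (hσ n).2 _ hP', ← mul_smul, ← pow_add, Nat.succ_mul,
        add_comm]
  refine ⟨σ, fun n => (hσ n).1, ?_, fun P hP => ?_⟩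
  · -- `ρ(σ)^m = 1`
    rw [← map_pow]
    refine LinearMap.ext fun a => ?_
    rw [WeierstrassCurve.galoisRepTate_apply_apply, Module.End.one_apply]
    refine TateModule.ext fun n => ?_
    rw [TateModule.proj_smul_of_distribMulAction,
      hσpow n m _ (TateModule.pow_smul_proj n a), pow_mul]
    have := hEfix n 1 (TateModule.proj p n a) (TateModule.pow_smul_proj n a)
    rwa [pow_one] at this
  · -- `σ = σ₁` on `E[p]`
    have h1 := (hσ 1).2 P (by rw [pow_one, hP])
    rw [h1]
    simp only [he, mul_one, hk]
    rw [pow_succ, mul_smul, pow_mul]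
    exact hEk k (σ₁ • P) (by rw [smul_comm, hP, smul_zero])

end Summit.BirchSwinnertonDyer.BirchSwinnertonDyer.Rank1Residual.TwistedIm
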